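import Summits.Parity.GeneralizedHardyLittlewood.Theses.GreenTaoLevelTwo
import Summits.Parity.GeneralizedHardyLittlewood.Theorems.GreenTaoLevelTwoHuaQuadraticRung
import Summits.Parity.GeneralizedHardyLittlewood.Theorems.GreenTaoLevelTwoMNTwoVerticalReductionStub

/-!
# BC3 birth skeleton — crux `MNTwo` (rank 3) of route `GreenTaoLevelTwo` (Parity / GeneralizedHardyLittlewood)

FORMALISATION-FIRST of a PRINTED theorem (FRONTIER rung; no new mathematics): `MNTwo` = `MN(2)`
(`GreenTao2010_MNAt 2 ((X.pow m).prod circle) M`, every `A`, constant uniform in `g, x` and in all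
`1`-bounded `M`-Lipschitz real `F`) for every member `X` of the Heisenberg class of `H_d`, every Def-8.1
box-comparable `d`.  Printed proof = Green–Tao 2008b (AIF 58 = arXiv:math/0606087, Main Theorem =
Thm. 1.1) / Green–Tao 2012a §3:
* `stub_mnVertical` (XL): the VERTICAL-CHARACTER case with POLYNOMIAL dependence on the Lipschitz
  constant: for `F = F₁ + iF₂` transforming under the centre of `G` by a character,
  `|∑_(n ≤ N) μ(n) F(gⁿx)| ≤ C M^B N log^(-A) N` (GT 2012a Thm. 1.1's `M^O(1)`; in the Heisenberg
  class this is AIF's bracket-quadratic exponential-sum estimate + Vaughan + Siegel–Walfisz);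
* `stub_verticalReduction` (L): Fejér / vertical Fourier expansion along the compact centre torus with
  polynomial losses (GT 2012a Lemma 3.7): an `M`-Lipschitz `F` is within `ε` of a sum of `(M/ε)^O(1)`
  vertical characters of Lipschitz constant `O(M)`; with `ε = log^(-A) N` the polynomial
  dependence of Stub 1 closes `MN(2)` for FIXED `M` and every `A`.
Composition `MNTwo_of` (modus ponens; BC2(b)) concludes the ROUTE decl
`Summit.Parity.GeneralizedHardyLittlewood.Theses.GreenTaoLevelTwo.MNTwo` by name.  Honours the T1
choice-metric trap (everything over `heisenbergWith d h`).  Siegel ⇒ `C` ineffective: stated `∃ C`.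

Lead revisions: (leafhand-parity-greentaoleveltwo-1 g0, 2026-08-30) the BC5 rung
`stub_rung_huaQuadratic` is discharged by the tree theorem `huaQuadraticRung_proof` (item 21367);
(leafhand-parity-greentaoleveltwo-1 g1, 2026-08-31) both stub signatures SPELLED OUT (no skeleton-local
definitions: `circleTwo ↦ Nilmanifold.circle.ofLE one_le_two`, `IsVertical`, `MNAtVerticalPoly`
inlined) so that by-name Theorems files can state them verbatim; `stub_verticalReduction` is proved in
`Theorems/GreenTaoLevelTwoMNTwoVerticalReductionStub.lean` (with the nine `…MNTwo*` helper files).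
-/

noncomputable section

namespace Summit.Parity.GeneralizedHardyLittlewood.Cruxes.MNTwo.Birth

open Literature.NumberTheory.Sieve
open Literature.NumberTheory.Sieve.GreenTaoLevelTwo (HX IsCompatMetric IsBoxComparable heisenbergWith
  InHeisClass)

/-- Stub 1 statement (XL), spelled out: `MN(2)` for VERTICAL CHARACTERS (pairs `F₁ + iF₂`
transforming under the centre by a character) with polynomial dependence on the Lipschitz constant,
over the whole Heisenberg class (`X^m × ℝ/ℤ`, `X ∈ 𝒞₂(H_d)`). -/
def Signature.stub_mnVertical : Prop :=
  (∀ (d : HX → HX → ℝ) (h : IsCompatMetric d), IsBoxComparable d →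
      ∀ X : Nilmanifold 2, InHeisClass (heisenbergWith d h) X → ∀ m : ℕ,
        ∀ A : ℝ, 0 < A → ∃ C B : ℝ, ∀ M : ℝ, 1 ≤ M → ∀ N : ℕ, 2 ≤ N →
          ∀ (g : ((X.pow m).prod (Nilmanifold.circle.ofLE one_le_two)).G) (x : ((X.pow m).prod (Nilmanifold.circle.ofLE one_le_two)).G ⧸ ((X.pow m).prod (Nilmanifold.circle.ofLE one_le_two)).Γ) (F₁ F₂ : ((X.pow m).prod (Nilmanifold.circle.ofLE one_le_two)).G ⧸ ((X.pow m).prod (Nilmanifold.circle.ofLE one_le_two)).Γ → ℝ),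
            ((X.pow m).prod (Nilmanifold.circle.ofLE one_le_two)).IsBoundedLipschitz M F₁ → ((X.pow m).prod (Nilmanifold.circle.ofLE one_le_two)).IsBoundedLipschitz M F₂ →
            (∃ θ : ((X.pow m).prod (Nilmanifold.circle.ofLE one_le_two)).G → ℝ, ∀ z : ((X.pow m).prod (Nilmanifold.circle.ofLE one_le_two)).G, z ∈ Subgroup.center ((X.pow m).prod (Nilmanifold.circle.ofLE one_le_two)).G →
              ∀ x : ((X.pow m).prod (Nilmanifold.circle.ofLE one_le_two)).G ⧸ ((X.pow m).prod (Nilmanifold.circle.ofLE one_le_two)).Γ,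
                ((F₁ (z • x) : ℂ) + (F₂ (z • x) : ℂ) * Complex.I) =
                  Complex.exp (2 * Real.pi * Complex.I * θ z) * ((F₁ x : ℂ) + (F₂ x : ℂ) * Complex.I)) →
              ‖∑ n ∈ Finset.Icc 1 N, ((ArithmeticFunction.moebius n : ℝ) : ℂ) *
                  ((F₁ (g ^ n • x) : ℂ) + (F₂ (g ^ n • x) : ℂ) * Complex.I)‖ ≤
                C * M ^ B * N / Real.log N ^ A)

/-- Stub 2 statement (L): vertical Fourier reduction with polynomial losses. -/
def Signature.stub_verticalReduction : Prop :=
  Signature.stub_mnVertical → Summit.Parity.GeneralizedHardyLittlewood.Theses.GreenTaoLevelTwo.MNTwo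

/-- Stub 1 (XL), registered with its statement SPELLED OUT (definitionally `Signature.stub_mnVertical`).
[cite: GreenTao2012Mobius, Thm. 1.1] [cite: GreenTao2008QuadraticMobius, Thm. 1.1] -/
theorem stub_mnVertical :
    (∀ (d : HX → HX → ℝ) (h : IsCompatMetric d), IsBoxComparable d →
      ∀ X : Nilmanifold 2, InHeisClass (heisenbergWith d h) X → ∀ m : ℕ,
        ∀ A : ℝ, 0 < A → ∃ C B : ℝ, ∀ M : ℝ, 1 ≤ M → ∀ N : ℕ, 2 ≤ N →
          ∀ (g : ((X.pow m).prod (Nilmanifold.circle.ofLE one_le_two)).G) (x : ((X.pow m).prod (Nilmanifold.circle.ofLE one_le_two)).G ⧸ ((X.pow m).prod (Nilmanifold.circle.ofLE one_le_two)).Γ) (F₁ F₂ : ((X.pow m).prod (Nilmanifold.circle.ofLE one_le_two)).G ⧸ ((X.pow m).prod (Nilmanifold.circle.ofLE one_le_two)).Γ → ℝ),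
            ((X.pow m).prod (Nilmanifold.circle.ofLE one_le_two)).IsBoundedLipschitz M F₁ → ((X.pow m).prod (Nilmanifold.circle.ofLE one_le_two)).IsBoundedLipschitz M F₂ →
            (∃ θ : ((X.pow m).prod (Nilmanifold.circle.ofLE one_le_two)).G → ℝ, ∀ z : ((X.pow m).prod (Nilmanifold.circle.ofLE one_le_two)).G, z ∈ Subgroup.center ((X.pow m).prod (Nilmanifold.circle.ofLE one_le_two)).G →
              ∀ x : ((X.pow m).prod (Nilmanifold.circle.ofLE one_le_two)).G ⧸ ((X.pow m).prod (Nilmanifold.circle.ofLE one_le_two)).Γ,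
                ((F₁ (z • x) : ℂ) + (F₂ (z • x) : ℂ) * Complex.I) =
                  Complex.exp (2 * Real.pi * Complex.I * θ z) * ((F₁ x : ℂ) + (F₂ x : ℂ) * Complex.I)) →
              ‖∑ n ∈ Finset.Icc 1 N, ((ArithmeticFunction.moebius n : ℝ) : ℂ) *
                  ((F₁ (g ^ n • x) : ℂ) + (F₂ (g ^ n • x) : ℂ) * Complex.I)‖ ≤
                C * M ^ B * N / Real.log N ^ A) := by
  sorry

/-- Stub 2 (L) is no longer a stub: it is PROVED in the tree (p801080) as
`Summit.Parity.GeneralizedHardyLittlewood.GreenTaoLevelTwoMNTwoVerticalReductionStub.stub_verticalReduction`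
(`Theorems/GreenTaoLevelTwoMNTwoVerticalReductionStub.lean`, with the helper files
`Theorems/GreenTaoLevelTwoMNTwo{VerticalReductionBookkeeping,CentralTranslation,CentralFrames,
VerticalComponents,VerticalSmoothing,VerticalMultiplier,VerticalTruncation,VerticalWeights,
VerticalWeightsExplicit,VerticalApproximation,VerticalHapprox}.lean`), whose statement is the plan's
`Signature.stub_verticalReduction` spelled out (definitional). [cite: GreenTao2012Mobius, Lemma 3.7] -/
theorem stub_verticalReduction :
    (∀ (d : HX → HX → ℝ) (h : IsCompatMetric d), IsBoxComparable d →
      ∀ X : Nilmanifold 2, InHeisClass (heisenbergWith d h) X → ∀ m : ℕ,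
        ∀ A : ℝ, 0 < A → ∃ C B : ℝ, ∀ M : ℝ, 1 ≤ M → ∀ N : ℕ, 2 ≤ N →
          ∀ (g : ((X.pow m).prod (Nilmanifold.circle.ofLE one_le_two)).G) (x : ((X.pow m).prod (Nilmanifold.circle.ofLE one_le_two)).G ⧸ ((X.pow m).prod (Nilmanifold.circle.ofLE one_le_two)).Γ) (F₁ F₂ : ((X.pow m).prod (Nilmanifold.circle.ofLE one_le_two)).G ⧸ ((X.pow m).prod (Nilmanifold.circle.ofLE one_le_two)).Γ → ℝ),
            ((X.pow m).prod (Nilmanifold.circle.ofLE one_le_two)).IsBoundedLipschitz M F₁ → ((X.pow m).prod (Nilmanifold.circle.ofLE one_le_two)).IsBoundedLipschitz M F₂ →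
            (∃ θ : ((X.pow m).prod (Nilmanifold.circle.ofLE one_le_two)).G → ℝ, ∀ z : ((X.pow m).prod (Nilmanifold.circle.ofLE one_le_two)).G, z ∈ Subgroup.center ((X.pow m).prod (Nilmanifold.circle.ofLE one_le_two)).G →
              ∀ x : ((X.pow m).prod (Nilmanifold.circle.ofLE one_le_two)).G ⧸ ((X.pow m).prod (Nilmanifold.circle.ofLE one_le_two)).Γ,
                ((F₁ (z • x) : ℂ) + (F₂ (z • x) : ℂ) * Complex.I) =
                  Complex.exp (2 * Real.pi * Complex.I * θ z) * ((F₁ x : ℂ) + (F₂ x : ℂ) * Complex.I)) →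
              ‖∑ n ∈ Finset.Icc 1 N, ((ArithmeticFunction.moebius n : ℝ) : ℂ) *
                  ((F₁ (g ^ n • x) : ℂ) + (F₂ (g ^ n • x) : ℂ) * Complex.I)‖ ≤
                C * M ^ B * N / Real.log N ^ A) →
      Summit.Parity.GeneralizedHardyLittlewood.Theses.GreenTaoLevelTwo.MNTwo :=
  Summit.Parity.GeneralizedHardyLittlewood.GreenTaoLevelTwoMNTwoVerticalReductionStub.stub_verticalReduction

/-- The spelled-out Stub 1 is the plan's `Signature.stub_mnVertical` (definitional). -/
example : Signature.stub_mnVertical := stub_mnVertical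

/-- The spelled-out Stub 2 is the plan's `Signature.stub_verticalReduction` (definitional). -/
example : Signature.stub_verticalReduction := stub_verticalReduction

/-- **Composition (kernel-checked)**: the one remaining stub gives the route crux BY NAME, through
the LANDED reduction `stub_verticalReduction`. -/
theorem MNTwo_of :
    Signature.stub_mnVertical →
      Summit.Parity.GeneralizedHardyLittlewood.Theses.GreenTaoLevelTwo.MNTwo :=
  fun h1 => stub_verticalReduction h1

/-- **The skeleton instantiated**: the crux BY NAME modulo the single remaining registered stub
`stub_mnVertical` (carries exactly its `sorry`). -/
theorem MNTwo_of_stubs : Summit.Parity.GeneralizedHardyLittlewood.Theses.GreenTaoLevelTwo.MNTwo :=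
  MNTwo_of stub_mnVertical

/-! ### BC5 rung (discharged) -/

/-- The BC5 rung (Hua's estimate `∑_(n ≤ N) μ(n) e(αn² + βn) ≪_A N log^(-A) N`) is DISCHARGED by the
tree: it is the route's support item `HuaQuadraticRung` (stmt-Parity-21367, CLOSED), proved as
`Summit.Parity.GeneralizedHardyLittlewood.Theorems.huaQuadraticRung_proof` (p565771); not a stub. -/
theorem rung_huaQuadratic : Summit.Parity.GeneralizedHardyLittlewood.Theses.GreenTaoLevelTwo.HuaQuadraticRung :=
  Summit.Parity.GeneralizedHardyLittlewood.Theorems.huaQuadraticRung_proof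

end Summit.Parity.GeneralizedHardyLittlewood.Cruxes.MNTwo.Birth
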